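import Literature.NumberTheory.Transcendental.BlochWignerDilogarithm
import Literature.NumberTheory.Transcendental.IdealTetrahedronVolumeIntegral
import HarnessLib

/-!
# The Bloch–Wigner dilogarithm as a real integral, and a Möbius symmetry

Topic `Literature/NumberTheory/Transcendental`. Third of three files proving the named fact
`BlochWigner_idealTetrahedronVolume` of `BlochWignerDilogarithm.lean` (`vol T(z) = D(z)` for
`Im z > 0`; Dupont 2001, Ch. 10, (10.9), p. 96). Write `z = a + ib`, `b > 0`, `N = |z|²`,
`A(u) = 1 - 2au + uN`, `B(u) = 1 - 2au + u²N = |1 - uz|²` as in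
`IdealTetrahedronVolumeIntegral.lean`, where `vol T(z) = ∫₀¹ (b/2B)(log A - log(A - B)) du` is
proved. Here (theorems only, no definitions):

* **The dilogarithm side.** With the tree's `Li₂(z) = -∫₀¹ log(1 - zs) ds/s` (principal `log`;
  for `Im z > 0` the segment `[0, z]` misses the cut) and `D(z) = Im Li₂(z) + arg(1 - z) log|z|`:
  - `dilog_im`: `Im Li₂(z) = -∫₀¹ Im log(1 - zs) ds/s` (the integrand is bounded by `N/b` on
    `(0,1]`: `‖log(1 - zs)‖ ≤ (N/b) s` by the mean value inequality, the derivative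
    `-z/(1 - zs)` having norm `≤ N/b` since `|1 - zs| ≥ b/|z|`);
  - `arg_one_sub_eq_integral`: `arg(1 - z) = -b ∫₀¹ ds/B(s)` (`d/ds Im log(1 - zs) = -b/B(s)`);
  - `integral_ell_im_div`: `∫₀¹ Im log(1-zs) ds/s = b ∫₀¹ log s ds/B(s)` — integration by parts
    in the form `∫₀¹ Ψ' = Ψ(1) - Ψ(0) = 0` for `Ψ(s) = Im log(1 - zs) · log s` (continuous on
    `[0,1]` since `|Ψ(s)| ≤ (N/b) s|log s| → 0`);
  - `blochWignerDilog_eq_integral`: **`D(z) = -b ∫₀¹ (log u + log|z|) du / B(u)`**.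
* **The Möbius symmetry** `integral_mobF_div_tB`: **`∫₀¹ (log A(u) + log u - log(1-u)) du/B(u) = 0`**.
  The involution `φ(u) = (1 - u)/A(u)` of `(0,1)` (`A = 1 + ku`, `1 + k = M = |1 - z|²`) satisfies
  `A(φu) = M/A(u)`, `1 - φu = uM/A(u)`, `B(φu) = M B(u)/A(u)²`, `|φ'(u)| = M/A(u)²`, hence
  `F(φu) = -F(u)` for `F = log A + log u - log(1-u)` and `|φ'| (F/B)∘φ = -F/B`; the change of
  variables `u ↦ φ(u)` (`MeasureTheory.integral_image_eq_integral_abs_deriv_smul`) gives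
  `∫ F/B = -∫ F/B`. (Geometrically `φ` is the reflection of the pencil of rays through the vertex
  `1` of the triangle `(0, 1, z)` in the angle bisector.)
* `volIntegrand_sub_dIntegrand`: on `(0,1)` the difference of the two integrands is
  `(b/2) F(u)/B(u)` (using `log(A - B) = log u + log(1-u) + log N`, `log N = 2 log|z|`).

The one-line conclusion `vol T(z) = D(z)` is appended to `BlochWignerDilogarithmProofs.lean`.

## References

* J. L. Dupont, *Scissors congruences, group homology and characteristic classes* (2001),
  Ch. 10, (10.9)–Thm. 10.10, p. 96. [`Dupont2001`]
* D. Zagier, *The dilogarithm function* (2007), Ch. I §3 (`D(z)`, its integral representations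
  and its role as a hyperbolic volume). [`Zagier2007Dilogarithm`]
* J. Milnor, *Hyperbolic geometry: the first 150 years* (1982), Appendix. [`Milnor1982`]
-/

noncomputable section

open MeasureTheory Set intervalIntegral
open scoped ENNReal Topology

namespace Literature.NumberTheory.Transcendental

namespace BlochWignerVolume

/-! ### The dilogarithm side -/

/-- `B(u) = |1 - z u|²` (the other order of the factors, cf. `tB_eq_normSq`). [folklore] -/
theorem tB_eq_normSq' (z : ℂ) (u : ℝ) : (1 - 2 * z.re * u + u ^ 2 * Complex.normSq z) =
    Complex.normSq (1 - z * u) := by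
  simp only [Complex.normSq_apply, Complex.sub_re, Complex.one_re, Complex.mul_re,
    Complex.ofReal_re, Complex.ofReal_im, Complex.sub_im, Complex.one_im, Complex.mul_im]
  ring

/-- `|1 - z|² > 0` for `Im z > 0`. [folklore] -/
theorem normSq_one_sub_pos {z : ℂ} (hz : 0 < z.im) : 0 < Complex.normSq (1 - z) := by
  refine Complex.normSq_pos.2 fun h => ?_
  have := congrArg Complex.im h
  simp at this
  exact hz.ne' this

/-- For `Im z > 0` and real `σ`, `1 - zσ` lies in the slit plane (off the cut of `log`). [folklore] -/
theorem one_sub_mul_mem_slitPlane {z : ℂ} (hz : 0 < z.im) (σ : ℝ) :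
    1 - z * (σ : ℂ) ∈ Complex.slitPlane := by
  rw [Complex.mem_slitPlane_iff]
  rcases eq_or_ne σ 0 with h | h
  · left; subst h; simp
  · right
    simp [hz.ne', h]

/-- `d/dσ log(1 - zσ) = -z / (1 - zσ)`. [folklore] -/
theorem hasDerivAt_ell {z : ℂ} (hz : 0 < z.im) (σ : ℝ) :
    HasDerivAt (fun x : ℝ => Complex.log (1 - z * (x : ℂ))) (-z / (1 - z * (σ : ℂ))) σ := by
  have h1 : HasDerivAt (fun x : ℝ => 1 - z * (x : ℂ)) (-z) σ := by
    simpa using (((hasDerivAt_id σ).ofReal_comp).const_mul z).const_sub 1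
  have h2 := (Complex.hasDerivAt_log (one_sub_mul_mem_slitPlane hz σ)).comp σ h1
  refine h2.congr_deriv ?_
  rw [div_eq_inv_mul]

/-- `Im (-z / (1 - zσ)) = -b / B(σ)`. [folklore] -/
theorem deriv_ell_im {z : ℂ} (σ : ℝ) : (-z / (1 - z * (σ : ℂ))).im = -z.im / (1 - 2 * z.re * σ + σ
    ^ 2 * Complex.normSq z) := by
  rw [tB_eq_normSq', Complex.div_im]
  simp only [Complex.neg_im, Complex.sub_re, Complex.one_re, Complex.mul_re, Complex.ofReal_re,
    Complex.ofReal_im, mul_zero, sub_zero, Complex.neg_re, Complex.sub_im, Complex.one_im,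
    Complex.mul_im, zero_sub]
  rw [div_sub_div_same]
  congr 1
  ring

/-- `d/dσ Im log(1 - zσ) = -b / B(σ)` (i.e. `d/dσ arg(1 - zσ)`). [folklore] -/
theorem hasDerivAt_ell_im {z : ℂ} (hz : 0 < z.im) (σ : ℝ) :
    HasDerivAt (fun x : ℝ => (Complex.log (1 - z * (x : ℂ))).im) (-z.im / (1 - 2 * z.re * σ + σ ^ 2
        * Complex.normSq z)) σ := by
  have h := (Complex.imCLM.hasFDerivAt).comp_hasDerivAt σ (hasDerivAt_ell hz σ)
  rw [← deriv_ell_im]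
  exact h

/-- `σ ↦ Im log(1 - zσ)` is continuous. [folklore] -/
theorem continuous_ell_im {z : ℂ} (hz : 0 < z.im) : Continuous fun x : ℝ => (Complex.log (1 - z *
    (x : ℂ))).im :=
  continuous_iff_continuousAt.2 fun σ => (hasDerivAt_ell_im hz σ).continuousAt

/-- The derivative bound `‖-z/(1 - zσ)‖ ≤ |z|²/b` (since `b = |Im(z̄(1 - zσ))| ≤ |z| |1 - zσ|`).
[folklore] -/
theorem norm_deriv_ell_le {z : ℂ} (hz : 0 < z.im) (σ : ℝ) :
    ‖-z / (1 - z * (σ : ℂ))‖ ≤ Complex.normSq z / z.im := by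
  have hw : (1 - z * (σ : ℂ)) ≠ 0 := Complex.slitPlane_ne_zero (one_sub_mul_mem_slitPlane hz σ)
  have key : z.im ≤ ‖z‖ * ‖1 - z * (σ : ℂ)‖ := by
    have h1 : ((starRingEnd ℂ) z * (1 - z * (σ : ℂ))).im = -z.im := by
      simp only [Complex.mul_im, Complex.conj_re, Complex.sub_im, Complex.one_im, Complex.mul_im,
        Complex.ofReal_re, Complex.ofReal_im, mul_zero, Complex.conj_im, Complex.sub_re,
        Complex.one_re, Complex.mul_re, sub_zero]
      ring
    have h2 := Complex.abs_im_le_norm ((starRingEnd ℂ) z * (1 - z * (σ : ℂ)))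
    rw [h1, abs_neg, abs_of_pos hz, norm_mul, Complex.norm_conj] at h2
    exact h2
  rw [norm_div, norm_neg, div_le_div_iff₀ (norm_pos_iff.2 hw) hz, Complex.normSq_eq_norm_sq]
  nlinarith [norm_nonneg z, norm_nonneg (1 - z * (σ : ℂ))]

/-- `‖log(1 - zs)‖ ≤ (|z|²/b) s` on `[0,1]` (mean value inequality). [folklore] -/
theorem norm_ell_le {z : ℂ} (hz : 0 < z.im) {s : ℝ} (hs : s ∈ Icc (0 : ℝ) 1) :
    ‖Complex.log (1 - z * (s : ℂ))‖ ≤ Complex.normSq z / z.im * s := by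
  have h := norm_image_sub_le_of_norm_deriv_le_segment' (f := fun x : ℝ => Complex.log (1 - z * (x
      : ℂ)))
    (a := 0) (b := 1) (fun x _ => (hasDerivAt_ell hz x).hasDerivWithinAt)
    (fun x _ => norm_deriv_ell_le hz x) s hs
  simpa using h

/-- The integrand `log(1 - zs)/s` of `Li₂(z)` is interval-integrable on `[0,1]` (bounded by
`|z|²/b`, continuous on `(0,1]`). [folklore] -/
theorem intervalIntegrable_dilogIntegrand {z : ℂ} (hz : 0 < z.im) :
    IntervalIntegrable (fun s : ℝ => Complex.log (1 - z * (s : ℂ)) / (s : ℂ)) volume 0 1 := by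
  refine IntervalIntegrable.mono_fun' (g := fun _ => Complex.normSq z / z.im)
    intervalIntegrable_const ?_ ?_
  · rw [Set.uIoc_of_le zero_le_one]
    refine ContinuousOn.aestronglyMeasurable ?_ measurableSet_Ioc
    refine ContinuousOn.div ?_ (by fun_prop) fun s hs => by exact_mod_cast hs.1.ne'
    exact ContinuousOn.clog (by fun_prop) fun s _ => one_sub_mul_mem_slitPlane hz s
  · rw [Set.uIoc_of_le zero_le_one]
    refine ae_restrict_of_forall_mem measurableSet_Ioc fun s hs => ?_
    dsimp only
    rw [norm_div, Complex.norm_real, Real.norm_of_nonneg hs.1.le, div_le_iff₀ hs.1]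
    exact norm_ell_le hz ⟨hs.1.le, hs.2⟩

/-- **`Im Li₂(z) = -∫₀¹ Im log(1 - zs) ds/s`** (`Im z > 0`). [cite: Dupont2001, Ch. 10, (10.9), p. 96] -/
theorem dilog_im {z : ℂ} (hz : 0 < z.im) :
    (dilog z).im = -∫ s in (0:ℝ)..1, (Complex.log (1 - z * (s : ℂ))).im / s := by
  rw [dilog, Complex.neg_im]
  congr 1
  have h := intervalIntegral_im (intervalIntegrable_dilogIntegrand hz)
  simp only [RCLike.im_to_complex] at h
  rw [← h]
  refine intervalIntegral.integral_congr fun s _ => ?_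
  simp only [Complex.div_ofReal_im]

/-- **`arg(1 - z) = -b ∫₀¹ dσ / B(σ)`** (fundamental theorem of calculus for `Im log(1 - zσ)`).
[folklore] -/
theorem arg_one_sub_eq_integral {z : ℂ} (hz : 0 < z.im) :
    Complex.arg (1 - z) = ∫ σ in (0:ℝ)..1, -z.im / (1 - 2 * z.re * σ + σ ^ 2 * Complex.normSq z) :=
        by
  have hcont : Continuous fun σ : ℝ => -z.im / (1 - 2 * z.re * σ + σ ^ 2 * Complex.normSq z) :=
    continuous_const.div (by fun_prop) fun σ => (tB_pos hz σ).ne'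
  rw [intervalIntegral.integral_eq_sub_of_hasDerivAt (fun σ _ => hasDerivAt_ell_im hz σ)
    (hcont.intervalIntegrable 0 1)]
  simp [Complex.log_im]

/-- `Ψ(s) = Im log(1 - zs) · log s` is continuous on `[0,1]` (at `0`: `|Ψ(s)| ≤ (N/b)·|s log s| → 0`,
and `Ψ(0) = 0` by `log 0 = 0`). [folklore] -/
theorem continuousOn_Psi {z : ℂ} (hz : 0 < z.im) :
    ContinuousOn (fun s : ℝ => (Complex.log (1 - z * (s : ℂ))).im * Real.log s) (Icc 0 1) := by
  intro s hs
  rcases eq_or_lt_of_le hs.1 with h | h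
  · subst h
    have h0 : (Complex.log (1 - z * ((0:ℝ) : ℂ))).im * Real.log 0 = 0 := by simp
    show Filter.Tendsto _ _ (𝓝 ((Complex.log (1 - z * ((0:ℝ) : ℂ))).im * Real.log 0))
    rw [h0]
    refine squeeze_zero_norm' (a := fun s : ℝ => Complex.normSq z / z.im * ‖s * Real.log s‖) ?_ ?_
    · filter_upwards [self_mem_nhdsWithin] with s hs
      rw [norm_mul, norm_mul, ← mul_assoc]
      refine mul_le_mul ?_ le_rfl (norm_nonneg _)
        (mul_nonneg (div_pos (normSq_pos_of_im_pos hz) hz).le (norm_nonneg _))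
      calc ‖(Complex.log (1 - z * (s : ℂ))).im‖ ≤ ‖Complex.log (1 - z * (s : ℂ))‖ :=
          Complex.abs_im_le_norm _
        _ ≤ Complex.normSq z / z.im * s := norm_ell_le hz hs
        _ = Complex.normSq z / z.im * ‖s‖ := by rw [Real.norm_of_nonneg hs.1]
    · have h1 := ((Real.continuous_mul_log.tendsto 0).norm.const_mul
        (Complex.normSq z / z.im)).mono_left (nhdsWithin_le_nhds (s := Icc (0:ℝ) 1))
      simpa using h1
  · exact ((continuous_ell_im hz).continuousAt.mul
      (Real.continuousAt_log h.ne')).continuousWithinAt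

/-- `s ↦ Im log(1 - zs) · s⁻¹` is interval-integrable on `[0,1]` (it is `Im` of the `Li₂`
integrand). [folklore] -/
theorem intervalIntegrable_ell_im_div {z : ℂ} (hz : 0 < z.im) :
    IntervalIntegrable (fun s : ℝ => (Complex.log (1 - z * (s : ℂ))).im * s⁻¹) volume 0 1 := by
  have h := intervalIntegrable_dilogIntegrand hz
  have h2 : IntervalIntegrable (fun s : ℝ => RCLike.im (Complex.log (1 - z * (s : ℂ)) / (s : ℂ)))
      volume 0 1 :=
    ⟨h.1.im, h.2.im⟩
  refine h2.congr fun s _ => ?_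
  simp only [RCLike.im_to_complex]
  rw [Complex.div_ofReal_im, div_eq_mul_inv]

/-- **Integration by parts**: `∫₀¹ Im log(1 - zs) ds/s = b ∫₀¹ log s ds / B(s)`, from
`∫₀¹ Ψ' = Ψ(1) - Ψ(0) = 0`, `Ψ(s) = Im log(1 - zs) · log s`. [folklore] -/
theorem integral_ell_im_div {z : ℂ} (hz : 0 < z.im) :
    ∫ s in (0:ℝ)..1, (Complex.log (1 - z * (s : ℂ))).im / s = ∫ s in (0:ℝ)..1, z.im / (1 - 2 * z.re
        * s + s ^ 2 * Complex.normSq z) * Real.log s := by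
  have hcont : Continuous fun σ : ℝ => -z.im / (1 - 2 * z.re * σ + σ ^ 2 * Complex.normSq z) :=
    continuous_const.div (by fun_prop) fun σ => (tB_pos hz σ).ne'
  have hint1 : IntervalIntegrable (fun s : ℝ => -z.im / (1 - 2 * z.re * s + s ^ 2 * Complex.normSq
      z) * Real.log s) volume 0 1 :=
    intervalIntegral.intervalIntegrable_log'.continuousOn_mul hcont.continuousOn
  have hint2 := intervalIntegrable_ell_im_div hz
  have hFTC := intervalIntegral.integral_eq_sub_of_hasDeriv_right_of_le zero_le_one
    (continuousOn_Psi hz)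
    (fun s hs => ((hasDerivAt_ell_im hz s).mul (Real.hasDerivAt_log hs.1.ne')).hasDerivWithinAt)
    (hint1.add hint2)
  simp only [Real.log_one, mul_zero, Real.log_zero, sub_self] at hFTC
  rw [intervalIntegral.integral_add hint1 hint2] at hFTC
  have h3 : ∫ s in (0:ℝ)..1, (Complex.log (1 - z * (s : ℂ))).im / s = ∫ s in (0:ℝ)..1, (Complex.log
      (1 - z * (s : ℂ))).im * s⁻¹ :=
    intervalIntegral.integral_congr fun s _ => by simp [div_eq_mul_inv]
  have h4 : ∫ s in (0:ℝ)..1, z.im / (1 - 2 * z.re * s + s ^ 2 * Complex.normSq z) * Real.log s =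
      -∫ s in (0:ℝ)..1, -z.im / (1 - 2 * z.re * s + s ^ 2 * Complex.normSq z) * Real.log s := by
    rw [← intervalIntegral.integral_neg]
    refine intervalIntegral.integral_congr fun s _ => by simp [neg_div]
  rw [h3, h4]
  linarith

/-- **The Bloch–Wigner dilogarithm as a real integral**: for `Im z > 0`,
`D(z) = -b ∫₀¹ (log u + log|z|) du / B(u)`, `B(u) = |1 - uz|²` (from Dupont's (10.9),
`D(z) = arg(1-z) log|z| + Im Li₂(z)`, by the two preceding computations).
[cite: Dupont2001, Ch. 10, (10.9), p. 96] -/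
theorem blochWignerDilog_eq_integral {z : ℂ} (hz : 0 < z.im) :
    blochWignerDilog z = ∫ u in (0:ℝ)..1, -(z.im / (1 - 2 * z.re * u + u ^ 2 * Complex.normSq z)) *
        (Real.log u + Real.log ‖z‖) := by
  have hcont : Continuous fun σ : ℝ => -z.im / (1 - 2 * z.re * σ + σ ^ 2 * Complex.normSq z) :=
    continuous_const.div (by fun_prop) fun σ => (tB_pos hz σ).ne'
  have hcont' : Continuous fun σ : ℝ => z.im / (1 - 2 * z.re * σ + σ ^ 2 * Complex.normSq z) :=
    continuous_const.div (by fun_prop) fun σ => (tB_pos hz σ).ne'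
  have hint1 : IntervalIntegrable (fun s : ℝ => -(z.im / (1 - 2 * z.re * s + s ^ 2 * Complex.normSq
      z) * Real.log s)) volume 0 1 :=
    (intervalIntegral.intervalIntegrable_log'.continuousOn_mul hcont'.continuousOn).neg
  have hint2 : IntervalIntegrable (fun s : ℝ => -z.im / (1 - 2 * z.re * s + s ^ 2 * Complex.normSq
      z) * Real.log ‖z‖) volume 0 1 :=
    (hcont.mul continuous_const).intervalIntegrable 0 1
  rw [blochWignerDilog, dilog_im hz, integral_ell_im_div hz, arg_one_sub_eq_integral hz,
    ← intervalIntegral.integral_mul_const, ← intervalIntegral.integral_neg,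
    ← intervalIntegral.integral_add hint1 hint2]
  refine intervalIntegral.integral_congr fun s _ => ?_
  ring

/-- The integrand of `D(z)` is interval-integrable on `[0,1]`. [folklore] -/
theorem intervalIntegrable_dIntegrand {z : ℂ} (hz : 0 < z.im) :
    IntervalIntegrable (fun u : ℝ => -(z.im / (1 - 2 * z.re * u + u ^ 2 * Complex.normSq z)) *
        (Real.log u + Real.log ‖z‖)) volume 0 1 := by
  have hcont' : Continuous fun σ : ℝ => z.im / (1 - 2 * z.re * σ + σ ^ 2 * Complex.normSq z) :=
    continuous_const.div (by fun_prop) fun σ => (tB_pos hz σ).ne'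
  have hint1 : IntervalIntegrable (fun s : ℝ => z.im / (1 - 2 * z.re * s + s ^ 2 * Complex.normSq
      z) * Real.log s) volume 0 1 :=
    intervalIntegral.intervalIntegrable_log'.continuousOn_mul hcont'.continuousOn
  have hint2 : IntervalIntegrable (fun s : ℝ => z.im / (1 - 2 * z.re * s + s ^ 2 * Complex.normSq
      z) * Real.log ‖z‖) volume 0 1 :=
    (hcont'.mul continuous_const).intervalIntegrable 0 1
  refine (hint1.add hint2).neg.congr fun u _ => ?_
  simp only [Pi.neg_apply]
  ring

/-! ### The Möbius symmetry of the volume integrand -/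

section Mobius

variable {z : ℂ} (hz : 0 < z.im) {u : ℝ} (hu : u ∈ Ioo (0 : ℝ) 1)
include hz hu

/-- `φ(u) = (1-u)/A(u) > 0` on `(0,1)`. [folklore] -/
theorem mob_pos : 0 < ((1 - u) / (1 - 2 * z.re * u + u * Complex.normSq z)) :=
  div_pos (sub_pos.2 hu.2) (tA_pos hz ⟨hu.1.le, hu.2.le⟩)

/-- `1 - φ(u) = u |1-z|² / A(u)`. [folklore] -/
theorem one_sub_mob : 1 - ((1 - u) / (1 - 2 * z.re * u + u * Complex.normSq z)) = u *
    Complex.normSq (1 - z) / (1 - 2 * z.re * u + u * Complex.normSq z) := by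
  have hA := (tA_pos hz ⟨hu.1.le, hu.2.le⟩).ne'
  rw [eq_div_iff hA, sub_mul, div_mul_cancel₀ _ hA]
  simp only [Complex.normSq_apply, Complex.sub_re, Complex.one_re, Complex.sub_im,
    Complex.one_im]
  ring

/-- `φ(u) < 1` on `(0,1)`. [folklore] -/
theorem mob_lt_one : ((1 - u) / (1 - 2 * z.re * u + u * Complex.normSq z)) < 1 := by
  have h := one_sub_mob hz hu
  have : 0 < u * Complex.normSq (1 - z) / (1 - 2 * z.re * u + u * Complex.normSq z) :=
    div_pos (mul_pos hu.1 (normSq_one_sub_pos hz)) (tA_pos hz ⟨hu.1.le, hu.2.le⟩)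
  linarith

/-- `φ` maps `(0,1)` into `(0,1)`. [folklore] -/
theorem mob_mem : ((1 - u) / (1 - 2 * z.re * u + u * Complex.normSq z)) ∈ Ioo (0 : ℝ) 1 := ⟨mob_pos
    hz hu, mob_lt_one hz hu⟩

/-- `A(φ(u)) = |1-z|² / A(u)`. [folklore] -/
theorem tA_mob : (1 - 2 * z.re * ((1 - u) / (1 - 2 * z.re * u + u * Complex.normSq z)) + ((1 - u) /
    (1 - 2 * z.re * u + u * Complex.normSq z)) * Complex.normSq z) = Complex.normSq (1 - z) / (1 -
    2 * z.re * u + u * Complex.normSq z) := by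
  have hA := (tA_pos hz ⟨hu.1.le, hu.2.le⟩).ne'
  rw [eq_div_iff hA]
  have key : ∀ v : ℝ, (1 - 2 * z.re * v + v * Complex.normSq z) * (1 - 2 * z.re * u + u *
      Complex.normSq z) =
      (1 - 2 * z.re * u + u * Complex.normSq z) - 2 * z.re * (v * (1 - 2 * z.re * u + u *
          Complex.normSq z)) + (v * (1 - 2 * z.re * u + u * Complex.normSq z)) * Complex.normSq z
          := by
    intro v; ring
  rw [key, div_mul_cancel₀ _ hA]
  simp only [Complex.normSq_apply, Complex.sub_re, Complex.one_re, Complex.sub_im,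
    Complex.one_im]
  ring

/-- `φ` is an involution: `φ(φ(u)) = u`. [folklore] -/
theorem mob_mob : ((1 - ((1 - u) / (1 - 2 * z.re * u + u * Complex.normSq z))) / (1 - 2 * z.re *
    ((1 - u) / (1 - 2 * z.re * u + u * Complex.normSq z)) + ((1 - u) / (1 - 2 * z.re * u + u *
    Complex.normSq z)) * Complex.normSq z)) = u := by
  have hA := (tA_pos hz ⟨hu.1.le, hu.2.le⟩).ne'
  have hM := (normSq_one_sub_pos hz).ne'
  rw [tA_mob hz hu, one_sub_mob hz hu, div_div_div_cancel_right₀ hA, mul_div_assoc, div_self hM,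
    mul_one]

/-- `B(φ(u)) = |1-z|² B(u) / A(u)²` (i.e. `|A(u) - (1-u)z|² = |1-z|² |1-uz|²`). [folklore] -/
theorem tB_mob : (1 - 2 * z.re * ((1 - u) / (1 - 2 * z.re * u + u * Complex.normSq z)) + ((1 - u) /
    (1 - 2 * z.re * u + u * Complex.normSq z)) ^ 2 * Complex.normSq z) = Complex.normSq (1 - z) *
    (1 - 2 * z.re * u + u ^ 2 * Complex.normSq z) / (1 - 2 * z.re * u + u * Complex.normSq z) ^ 2
    := by
  have hA := (tA_pos hz ⟨hu.1.le, hu.2.le⟩).ne'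
  rw [eq_div_iff (pow_ne_zero 2 hA)]
  have key : ∀ v : ℝ, (1 - 2 * z.re * v + v ^ 2 * Complex.normSq z) * (1 - 2 * z.re * u + u *
      Complex.normSq z) ^ 2 =
      ((1 - 2 * z.re * u + u * Complex.normSq z) - 2 * z.re * (v * (1 - 2 * z.re * u + u *
          Complex.normSq z))) * (1 - 2 * z.re * u + u * Complex.normSq z) + (v * (1 - 2 * z.re * u
          + u * Complex.normSq z)) ^ 2 * Complex.normSq z := by
    intro v; ring
  rw [key, div_mul_cancel₀ _ hA]
  simp only [Complex.normSq_apply, Complex.sub_re, Complex.one_re, Complex.sub_im,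
    Complex.one_im]
  ring

/-- `φ'(u) = -|1-z|² / A(u)²`. [folklore] -/
theorem hasDerivAt_mob : HasDerivAt (fun u : ℝ => ((1 - u) / (1 - 2 * z.re * u + u * Complex.normSq
    z))) (-Complex.normSq (1 - z) / (1 - 2 * z.re * u + u * Complex.normSq z) ^ 2) u := by
  have hA := (tA_pos hz ⟨hu.1.le, hu.2.le⟩).ne'
  have h1 : HasDerivAt (fun u : ℝ => 1 - u) (-1) u := by
    simpa using (hasDerivAt_id u).const_sub 1
  have h2 : HasDerivAt (fun u : ℝ => (1 - 2 * z.re * u + u * Complex.normSq z)) (Complex.normSq (1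
      - z) - 1) u := by
    have h := (((hasDerivAt_id u).const_mul (2 * z.re)).const_sub 1).add
      ((hasDerivAt_id u).mul_const (Complex.normSq z))
    refine (h.congr_deriv ?_)
    simp only [Complex.normSq_apply, Complex.sub_re, Complex.one_re, Complex.sub_im,
      Complex.one_im, mul_one, one_mul]
    ring
  have h3 := h1.div h2 hA
  refine h3.congr_deriv ?_
  field_simp
  simp only [Complex.normSq_apply, Complex.sub_re, Complex.one_re, Complex.sub_im,
    Complex.one_im]
  ring

/-- `F(φ(u)) = -F(u)` for `F = log A + log u - log (1-u)`. [folklore] -/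
theorem mobF_mob : (Real.log (1 - 2 * z.re * ((1 - u) / (1 - 2 * z.re * u + u * Complex.normSq z))
    + ((1 - u) / (1 - 2 * z.re * u + u * Complex.normSq z)) * Complex.normSq z) + Real.log ((1 - u)
    / (1 - 2 * z.re * u + u * Complex.normSq z)) - Real.log (1 - ((1 - u) / (1 - 2 * z.re * u + u *
    Complex.normSq z)))) = -(Real.log (1 - 2 * z.re * u + u * Complex.normSq z) + Real.log u -
    Real.log (1 - u)) := by
  have hA := tA_pos hz ⟨hu.1.le, hu.2.le⟩
  have hM := normSq_one_sub_pos hz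
  have h1u : 0 < 1 - u := sub_pos.2 hu.2
  rw [tA_mob hz hu, one_sub_mob hz hu, Real.log_div hM.ne' hA.ne',
    Real.log_div h1u.ne' hA.ne', Real.log_div (mul_pos hu.1 hM).ne' hA.ne',
    Real.log_mul hu.1.ne' hM.ne']
  ring

/-- The pointwise identity behind the change of variables: `|φ'(u)| · (F/B)(φ(u)) = -(F/B)(u)`.
[folklore] -/
theorem mob_pointwise :
    |(-Complex.normSq (1 - z) / (1 - 2 * z.re * u + u * Complex.normSq z) ^ 2)| • ((Real.log (1 - 2
        * z.re * ((1 - u) / (1 - 2 * z.re * u + u * Complex.normSq z)) + ((1 - u) / (1 - 2 * z.re *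
        u + u * Complex.normSq z)) * Complex.normSq z) + Real.log ((1 - u) / (1 - 2 * z.re * u + u
        * Complex.normSq z)) - Real.log (1 - ((1 - u) / (1 - 2 * z.re * u + u * Complex.normSq
        z)))) / (1 - 2 * z.re * ((1 - u) / (1 - 2 * z.re * u + u * Complex.normSq z)) + ((1 - u) /
        (1 - 2 * z.re * u + u * Complex.normSq z)) ^ 2 * Complex.normSq z)) = -((Real.log (1 - 2 *
        z.re * u + u * Complex.normSq z) + Real.log u - Real.log (1 - u)) / (1 - 2 * z.re * u + u ^
        2 * Complex.normSq z)) := by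
  have hA := tA_pos hz ⟨hu.1.le, hu.2.le⟩
  have hM := normSq_one_sub_pos hz
  have hB := tB_pos hz u
  rw [mobF_mob hz hu, tB_mob hz hu, neg_div, abs_neg, abs_of_pos (div_pos hM (pow_pos hA 2)),
    smul_eq_mul]
  field_simp

end Mobius

/-- `φ((0,1)) = (0,1)`. [folklore] -/
theorem mob_image {z : ℂ} (hz : 0 < z.im) :
    (fun u : ℝ => ((1 - u) / (1 - 2 * z.re * u + u * Complex.normSq z))) '' Ioo (0 : ℝ) 1 = Ioo 0 1
        := by
  ext v
  constructor
  · rintro ⟨u, hu, rfl⟩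
    exact mob_mem hz hu
  · intro hv
    exact ⟨((1 - v) / (1 - 2 * z.re * v + v * Complex.normSq z)), mob_mem hz hv, mob_mob hz hv⟩

/-- `φ` is injective on `(0,1)`. [folklore] -/
theorem mob_injOn {z : ℂ} (hz : 0 < z.im) : InjOn (fun u : ℝ => ((1 - u) / (1 - 2 * z.re * u + u *
    Complex.normSq z))) (Ioo (0 : ℝ) 1) := by
  intro u hu v hv h
  have h' : ((1 - u) / (1 - 2 * z.re * u + u * Complex.normSq z)) = ((1 - v) / (1 - 2 * z.re * v +
      v * Complex.normSq z)) := h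
  rw [← mob_mob hz hu, ← mob_mob hz hv, h']

/-- **The Möbius symmetry**: `∫₀¹ (log A(u) + log u - log (1-u)) du / B(u) = 0`, by the change of
variables `u ↦ φ(u) = (1-u)/A(u)` under which the integrand is odd. [folklore] -/
theorem integral_mobF_div_tB {z : ℂ} (hz : 0 < z.im) :
    ∫ u in Ioo (0 : ℝ) 1, (Real.log (1 - 2 * z.re * u + u * Complex.normSq z) + Real.log u -
        Real.log (1 - u)) / (1 - 2 * z.re * u + u ^ 2 * Complex.normSq z) = 0 := by
  have h := integral_image_eq_integral_abs_deriv_smul measurableSet_Ioo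
    (f := fun u : ℝ => ((1 - u) / (1 - 2 * z.re * u + u * Complex.normSq z))) (f' := fun u : ℝ =>
        -Complex.normSq (1 - z) / (1 - 2 * z.re * u + u * Complex.normSq z) ^ 2)
    (fun u hu => (hasDerivAt_mob hz hu).hasDerivWithinAt) (mob_injOn hz)
    (fun u => (Real.log (1 - 2 * z.re * u + u * Complex.normSq z) + Real.log u - Real.log (1 - u))
        / (1 - 2 * z.re * u + u ^ 2 * Complex.normSq z))
  rw [mob_image hz] at h
  have h2 : ∫ u in Ioo (0 : ℝ) 1, |(-Complex.normSq (1 - z) / (1 - 2 * z.re * u + u *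
      Complex.normSq z) ^ 2)| • ((Real.log (1 - 2 * z.re * ((1 - u) / (1 - 2 * z.re * u + u *
      Complex.normSq z)) + ((1 - u) / (1 - 2 * z.re * u + u * Complex.normSq z)) * Complex.normSq
      z) + Real.log ((1 - u) / (1 - 2 * z.re * u + u * Complex.normSq z)) - Real.log (1 - ((1 - u)
      / (1 - 2 * z.re * u + u * Complex.normSq z)))) / (1 - 2 * z.re * ((1 - u) / (1 - 2 * z.re * u
      + u * Complex.normSq z)) + ((1 - u) / (1 - 2 * z.re * u + u * Complex.normSq z)) ^ 2 *
      Complex.normSq z)) =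
      -∫ u in Ioo (0 : ℝ) 1, (Real.log (1 - 2 * z.re * u + u * Complex.normSq z) + Real.log u -
          Real.log (1 - u)) / (1 - 2 * z.re * u + u ^ 2 * Complex.normSq z) := by
    rw [← MeasureTheory.integral_neg]
    exact setIntegral_congr_fun measurableSet_Ioo fun u hu => mob_pointwise hz hu
  have h3 := h.trans h2
  linarith

/-! ### Comparison of the two integrands -/

/-- On `(0,1)` the volume integrand minus the dilogarithm integrand is `(b/2) F(u)/B(u)`,
`F = log A + log u - log(1-u)`. [folklore] -/
theorem volIntegrand_sub_dIntegrand {z : ℂ} (hz : 0 < z.im) {u : ℝ} (hu : u ∈ Ioo (0:ℝ) 1) :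
    z.im / (2 * (1 - 2 * z.re * u + u ^ 2 * Complex.normSq z)) * (Real.log (1 - 2 * z.re * u + u *
        Complex.normSq z) - Real.log ((1 - 2 * z.re * u + u * Complex.normSq z) - (1 - 2 * z.re * u
        + u ^ 2 * Complex.normSq z))) - -(z.im / (1 - 2 * z.re * u + u ^ 2 * Complex.normSq z)) *
        (Real.log u + Real.log ‖z‖) = z.im / 2 * ((Real.log (1 - 2 * z.re * u + u * Complex.normSq
        z) + Real.log u - Real.log (1 - u)) / (1 - 2 * z.re * u + u ^ 2 * Complex.normSq z)) := by
  rw [volIntegrand_eq hz hu, Complex.normSq_eq_norm_sq, Real.log_pow]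
  have hB := (tB_pos hz u).ne'
  field_simp
  push_cast
  ring

end BlochWignerVolume

end Literature.NumberTheory.Transcendental
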